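import Summits.ValiantsHypothesis.ValiantsHypothesis.Theorems.LacunarySymmetroidMatrixDescartesDoorA26WallBubblingDoublyConfluentNondeg

/-!
# Wall bubbling for `DoorA26` — TWO WEYL PAIRS ON THE WALL (c1) `e₀ + e₁ = e₂ + e₃`: NON-DEGENERACY of the limit BY INERTIA

LINE / STUBS.  Crux `Theses.LacunarySymmetroid.DoorA26` (stmt-ValiantsHypothesis-19979; OPEN, typed, never asserted), line
`Cruxes/DoorA26/Lines/wall_bubbling.lean` (val-idea-15), obligation (W) `Stmt.stub_weylFaces`; statement file
`Cruxes/DoorA26/Lines/wall_bubbling_ConfluentDoor.lean` rev 4, stratum `Stmt.weylFaces_wall` with TWO Weyl pairs `δ₀ = δ₅ = e₀`, `δ₁ = δ₄ = e₁`,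
singles `e₂, e₃`, and the CROSS relation (c2) `e₀ + e₂ = e₁ + e₃` (W1 #14 itemisation; NAMED OPEN R2779; (c3) `e₀ + e₃ = e₁ + e₂` is (c2) with the
singles swapped).  Seat val-sym-door-p2 g13 (W1 #26b).

THE POINT (as in W1 #26 `…DoublyConfluentNondeg`, value-generic).  On the wall (c1) the slot functions of the two-dslope frame have TWO
coincidences: `φ₀φ₄ = φ₅φ₁` (always) and `φ₀φ₁ = φ₂φ₃` (the wall).  A realisable non-zero limit Gram `c` gives the zero function iff
`c = x(E₀₄−E₁₅) + y(E₀₁−E₂₃)` (symmetrised); restricting to the letter block `{0,1,2,3}` isolates `y` as a multiple of the disjoint pattern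
(NOT realisable, `not_realisable_disjointPattern`, inertia (2,2), W1 #13), and then `{0,1,4,5}` isolates `x`.  Hence (def-free):

* `fourC1_model`, `twoPairC1_lonely`, `twoPairC1_special04_iff`, `twoPairC1_special01_iff` (`decide`) — the wall stratum (c1) is modelled by the
  integer vector `vv = ![0,5,2,3,5,0]` (`0+5 = 2+3`, no other coincidence); its slot classes;
* **`doublyConfluentDet_ne_zero_of_polar_ne_zero_wallC1`** — at a two-Weyl-pair point on the wall (c1) (`hrel : δ0 0 + δ0 1 = δ0 2 + δ0 3` and
  `hgen`: no OTHER coincidence among the pair sums of the four values), a symmetric frame `W` with one non-zero polar Gram entry has a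
  doubly-confluent determinant that is NOT identically zero.

USE: with `doublyConfluentLimit` (W1 #27), `multiplicity_transfer_iteratedDeriv` (W2) and the COUNT `doublyConfluent_count_conclusion` (W1 #24)
the single-cluster branch at the wall stratum (c1) is DOOR-FREE (W1 #28).  Nothing in this file bears on
(W)/(M)/(R) themselves, on `DoorA26`, on `MatrixDescartes` (stmt-ValiantsHypothesis-18050) or on `VP ≠ VNP`; registers unchanged.
`--supports stmt-ValiantsHypothesis-19979 --as helper`.

[this work] the inertia argument for the two coinciding slots.
-/

-- `Summit.ValiantsHypothesis.ValiantsHypothesis.…` repeats a component by the D-0017 layout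
-- (single-conjunct summit), which the `dupNamespace` linter flags; the name is mandated.
set_option linter.dupNamespace false

namespace Summit.ValiantsHypothesis.ValiantsHypothesis.Theorems.LacunarySymmetroidMatrixDescartes.WallBubbling

open Finset Filter Topology Polynomial
open Bubbling (polar polar_comm polar_self realisable_polarGram realisable_smul Realisable)
open SecondOrder (not_realisable_disjointPattern realisable_blockRestrict_smul)
open scoped BigOperators

/-! ## 1. Slot bookkeeping on the wall (c1) (integer model, decidable keys) -/

/-- **Integer model of the wall (c1)** (`decide`): for `v = ![0,5,2,3]` (`v 0 + v 1 = v 2 + v 3`, no other coincidence), `v a + v b = v c + v e`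
iff the pairs agree or form the wall relation `{0,1} ~ {2,3}`. [folklore] -/
theorem fourC1_model (v : Fin 4 → ℕ) (hvd : v = ![0, 5, 2, 3]) :
    ∀ a b c e : Fin 4, v a + v b = v c + v e ↔
      ((a = c ∧ b = e) ∨ (a = e ∧ b = c) ∨
        (((a = 0 ∧ b = 1) ∨ (a = 1 ∧ b = 0)) ∧ ((c = 2 ∧ e = 3) ∨ (c = 3 ∧ e = 2))) ∨
        (((a = 2 ∧ b = 3) ∨ (a = 3 ∧ b = 2)) ∧ ((c = 0 ∧ e = 1) ∨ (c = 1 ∧ e = 0)))) := by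
  subst hvd
  decide

/-- **Lonely classes on the wall (c1)** (`decide`): with the model `vv = ![0,5,2,3,5,0]` of the frame exponents and the confluent degree
`d = ![0,0,0,0,1,1]`, every slot class outside the eight special ordered pairs is a single unordered frame pair. [this work] -/
theorem twoPairC1_lonely (vv : Fin 6 → ℕ) (hvv : vv = ![0, 5, 2, 3, 5, 0]) (d : Fin 6 → ℕ) (hd : d = ![0, 0, 0, 0, 1, 1]) :
    ∀ p q p₀ q₀ : Fin 6, (vv p + vv q = vv p₀ + vv q₀ ∧ d p + d q = d p₀ + d q₀) →
      ¬ ((p₀ = 0 ∧ q₀ = 4) ∨ (p₀ = 4 ∧ q₀ = 0) ∨ (p₀ = 1 ∧ q₀ = 5) ∨ (p₀ = 5 ∧ q₀ = 1) ∨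
          (p₀ = 0 ∧ q₀ = 1) ∨ (p₀ = 1 ∧ q₀ = 0) ∨ (p₀ = 2 ∧ q₀ = 3) ∨ (p₀ = 3 ∧ q₀ = 2)) →
      (p = p₀ ∧ q = q₀) ∨ (p = q₀ ∧ q = p₀) := by
  subst hvv hd
  intro p q p₀ q₀
  revert p q
  fin_cases p₀ <;> fin_cases q₀ <;> decide

/-- The model class of `(0,4)` on the wall (c1) (`decide`). [this work] -/
theorem twoPairC1_special04_iff (vv : Fin 6 → ℕ) (hvv : vv = ![0, 5, 2, 3, 5, 0]) (d : Fin 6 → ℕ) (hd : d = ![0, 0, 0, 0, 1, 1]) :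
    ∀ p q : Fin 6, ((vv p + vv q = vv 0 + vv 4 ∧ d p + d q = d 0 + d 4) ↔
        ((p = 0 ∧ q = 4) ∨ (p = 4 ∧ q = 0) ∨ (p = 1 ∧ q = 5) ∨ (p = 5 ∧ q = 1))) := by
  subst hvv hd
  decide

/-- The model class of `(0,1)` on the wall (c1) (`decide`). [this work] -/
theorem twoPairC1_special01_iff (vv : Fin 6 → ℕ) (hvv : vv = ![0, 5, 2, 3, 5, 0]) (d : Fin 6 → ℕ) (hd : d = ![0, 0, 0, 0, 1, 1]) :
    ∀ p q : Fin 6, ((vv p + vv q = vv 0 + vv 1 ∧ d p + d q = d 0 + d 1) ↔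
        ((p = 0 ∧ q = 1) ∨ (p = 1 ∧ q = 0) ∨ (p = 2 ∧ q = 3) ∨ (p = 3 ∧ q = 2))) := by
  subst hvv hd
  decide

/-! ## 2. Non-degeneracy on the wall (c1) -/

/-- **NON-DEGENERACY OF THE DOUBLY-CONFLUENT LIMIT ON THE WALL (c1).**  Positions: pair A at `0,5` (`δ0 5 = δ0 0`), pair B at `1,4`
(`δ0 4 = δ0 1`), singles at `2, 3`; the wall relation `δ0 0 + δ0 1 = δ0 2 + δ0 3` holds (`hrel`) and is the ONLY coincidence among the pair sums of the
four values (`hgen`).  If the letters `W` are symmetric and some polar Gram entry is non-zero, the doubly-confluent determinant is not identically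
zero. [this work] -/
theorem doublyConfluentDet_ne_zero_of_polar_ne_zero_wallC1 (δ0 : Fin 6 → ℝ) (h50 : δ0 5 = δ0 0) (h41 : δ0 4 = δ0 1)
    (hrel : δ0 0 + δ0 1 = δ0 2 + δ0 3)
    (hgen : ∀ a b c e : Fin 4, δ0 a.castSucc.castSucc + δ0 b.castSucc.castSucc = δ0 c.castSucc.castSucc + δ0 e.castSucc.castSucc →
      (a = c ∧ b = e) ∨ (a = e ∧ b = c) ∨
        (((a = 0 ∧ b = 1) ∨ (a = 1 ∧ b = 0)) ∧ ((c = 2 ∧ e = 3) ∨ (c = 3 ∧ e = 2))) ∨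
        (((a = 2 ∧ b = 3) ∨ (a = 3 ∧ b = 2)) ∧ ((c = 0 ∧ e = 1) ∨ (c = 1 ∧ e = 0))))
    (W : Fin 6 → Matrix (Fin 2) (Fin 2) ℝ) (hWs : ∀ l, (W l).IsSymm) (hW : ∃ p q, polar (W p) (W q) ≠ 0) :
    ∃ t, ((Real.exp (δ0 0 * t)) • (W 0 + t • W 5) + (Real.exp (δ0 1 * t)) • (W 1 + t • W 4)
        + ∑ k : Fin 2, (Real.exp (δ0 k.succ.succ.castSucc.castSucc * t)) • W k.succ.succ.castSucc.castSucc).det ≠ 0 := by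
  classical
  by_contra hall
  push Not at hall
  set ρ : Fin 6 → Fin 4 := ![0, 1, 2, 3, 1, 0] with hρdef
  set v : Fin 4 → ℕ := ![0, 5, 2, 3] with hvd
  set vv : Fin 6 → ℕ := ![0, 5, 2, 3, 5, 0] with hvvd
  set dg : Fin 6 → ℕ := ![0, 0, 0, 0, 1, 1] with hdgdef
  have hρ : ∀ l : Fin 6, δ0 l = δ0 (ρ l).castSucc.castSucc := by
    intro l
    fin_cases l
    · rfl
    · rfl
    · rfl
    · rfl
    · exact h41
    · exact h50
  have hvvρ : ∀ l : Fin 6, vv l = v (ρ l) := by intro l; fin_cases l <;> rfl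
  have hmodel := fourC1_model v hvd
  have h0 : δ0 (Fin.castSucc (Fin.castSucc (0 : Fin 4))) = δ0 0 := rfl
  have h1 : δ0 (Fin.castSucc (Fin.castSucc (1 : Fin 4))) = δ0 1 := rfl
  have h2 : δ0 (Fin.castSucc (Fin.castSucc (2 : Fin 4))) = δ0 2 := rfl
  have h3 : δ0 (Fin.castSucc (Fin.castSucc (3 : Fin 4))) = δ0 3 := rfl
  -- the model describes the coincidences of the frame exponents exactly
  have hv : ∀ p q p₀ q₀ : Fin 6, δ0 p + δ0 q = δ0 p₀ + δ0 q₀ ↔ vv p + vv q = vv p₀ + vv q₀ := by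
    intro p q p₀ q₀
    rw [hρ p, hρ q, hρ p₀, hρ q₀, hvvρ p, hvvρ q, hvvρ p₀, hvvρ q₀, hmodel]
    constructor
    · exact hgen _ _ _ _
    · rintro (⟨ha, hb⟩ | ⟨ha, hb⟩ | ⟨(⟨ha, hb⟩ | ⟨ha, hb⟩), (⟨hc, he⟩ | ⟨hc, he⟩)⟩ | ⟨(⟨ha, hb⟩ | ⟨ha, hb⟩), (⟨hc, he⟩ | ⟨hc, he⟩)⟩)
      · rw [ha, hb]
      · rw [ha, hb, add_comm]
      all_goals
        rw [ha, hb, hc, he]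
        simp only [h0, h1, h2, h3]
        linarith [hrel]
  have hσ := twoPair_classSums_of_det_zero δ0 h50 h41 vv hv dg hdgdef W hall
  -- lonely entries vanish
  have hzero : ∀ p₀ q₀ : Fin 6, ¬ ((p₀ = 0 ∧ q₀ = 4) ∨ (p₀ = 4 ∧ q₀ = 0) ∨ (p₀ = 1 ∧ q₀ = 5) ∨ (p₀ = 5 ∧ q₀ = 1) ∨
          (p₀ = 0 ∧ q₀ = 1) ∨ (p₀ = 1 ∧ q₀ = 0) ∨ (p₀ = 2 ∧ q₀ = 3) ∨ (p₀ = 3 ∧ q₀ = 2)) →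
      polar (W p₀) (W q₀) = 0 := by
    intro p₀ q₀ hsp
    refine polar_eq_zero_of_lonely_classSum W p₀ q₀
      (fun p q => (vv p + vv q = vv p₀ + vv q₀ ∧ dg p + dg q = dg p₀ + dg q₀)) ?_ (hσ p₀ q₀)
    intro p q
    constructor
    · exact fun hk => twoPairC1_lonely vv hvvd dg hdgdef p q p₀ q₀ hk hsp
    · rintro (⟨rfl, rfl⟩ | ⟨rfl, rfl⟩)
      · exact ⟨rfl, rfl⟩
      · exact ⟨add_comm _ _, add_comm _ _⟩
  -- the two special classes
  set x : ℝ := polar (W 0) (W 4) with hx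
  set y : ℝ := polar (W 0) (W 1) with hy
  have hrelx : polar (W 1) (W 5) = -x := by
    have h := hσ 0 4
    simp only [twoPairC1_special04_iff vv hvvd dg hdgdef] at h
    simp [Fin.sum_univ_six] at h
    linarith [h, polar_comm (W 4) (W 0), polar_comm (W 5) (W 1)]
  have hrely : polar (W 2) (W 3) = -y := by
    have h := hσ 0 1
    simp only [twoPairC1_special01_iff vv hvvd dg hdgdef] at h
    simp [Fin.sum_univ_six] at h
    linarith [h, polar_comm (W 1) (W 0), polar_comm (W 3) (W 2)]
  -- hence every polar Gram entry is a combination of the two disjoint patterns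
  have hentry : ∀ a b : Fin 6, polar (W a) (W b)
      = x * ((if a = 0 ∧ b = 4 then (1 : ℝ) else 0) + (if a = 4 ∧ b = 0 then 1 else 0)
          - (if a = 1 ∧ b = 5 then 1 else 0) - (if a = 5 ∧ b = 1 then 1 else 0))
        + y * ((if a = 0 ∧ b = 1 then (1 : ℝ) else 0) + (if a = 1 ∧ b = 0 then 1 else 0)
          - (if a = 2 ∧ b = 3 then 1 else 0) - (if a = 3 ∧ b = 2 then 1 else 0)) := by
    intro a b
    by_cases hs : (a = 0 ∧ b = 4) ∨ (a = 4 ∧ b = 0) ∨ (a = 1 ∧ b = 5) ∨ (a = 5 ∧ b = 1) ∨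
          (a = 0 ∧ b = 1) ∨ (a = 1 ∧ b = 0) ∨ (a = 2 ∧ b = 3) ∨ (a = 3 ∧ b = 2)
    · rcases hs with ⟨rfl, rfl⟩ | ⟨rfl, rfl⟩ | ⟨rfl, rfl⟩ | ⟨rfl, rfl⟩ | ⟨rfl, rfl⟩ | ⟨rfl, rfl⟩ | ⟨rfl, rfl⟩ | ⟨rfl, rfl⟩
      · simpa using hx.symm
      · rw [polar_comm]; simpa using hx.symm
      · simp [hrelx]
      · rw [polar_comm]; simp [hrelx]
      · simpa using hy.symm
      · rw [polar_comm]; simpa using hy.symm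
      · simp [hrely]
      · rw [polar_comm]; simp [hrely]
    · rw [hzero a b hs]
      simp only [not_or] at hs
      obtain ⟨h1, h2, h3, h4, h5, h6, h7, h8⟩ := hs
      rw [if_neg h1, if_neg h2, if_neg h3, if_neg h4, if_neg h5, if_neg h6, if_neg h7, if_neg h8]
      ring
  -- the realisable polar Gram and its block restrictions
  have hG := realisable_polarGram W hWs
  have hB1 : ∀ a : Fin 6, a ∈ ({0, 1, 4, 5} : Finset (Fin 6)) ↔ (a = 0 ∨ a = 1 ∨ a = 4 ∨ a = 5) := by decide
  have hB2 : ∀ a : Fin 6, a ∈ ({0, 1, 2, 3} : Finset (Fin 6)) ↔ (a = 0 ∨ a = 1 ∨ a = 2 ∨ a = 3) := by decide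
  by_cases hy0 : y ≠ 0
  · -- block {0,1,2,3}: `y⁻¹ ×` the restriction is the disjoint pattern `(0,1 | 2,3)`
    have hreal := realisable_blockRestrict_smul hG ({0, 1, 2, 3} : Finset (Fin 6)) y⁻¹
    refine not_realisable_disjointPattern 0 1 2 3 (by decide) (by decide) (by decide) (by decide) (by decide) (by decide) ?_
    convert hreal using 1
    ext a b
    rw [Matrix.of_apply, Matrix.of_apply, Matrix.of_apply]
    by_cases hab : a ∈ ({0, 1, 2, 3} : Finset (Fin 6)) ∧ b ∈ ({0, 1, 2, 3} : Finset (Fin 6))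
    · rw [if_pos hab, hentry a b]
      obtain ⟨ha, hb⟩ := hab
      rw [hB2] at ha hb
      rcases ha with rfl | rfl | rfl | rfl <;> rcases hb with rfl | rfl | rfl | rfl <;> simp [hy0]
    · rw [if_neg hab]
      simp only [not_and_or, hB2, not_or] at hab
      rcases hab with ⟨h1, h2, h3, h4⟩ | ⟨h1, h2, h3, h4⟩
      · simp [h1, h2, h3, h4]
      · simp [h1, h2, h3, h4]
  · push Not at hy0
    by_cases hx0 : x ≠ 0
    · -- block {0,1,4,5}: `x⁻¹ ×` the restriction is the disjoint pattern `(0,4 | 1,5)`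
      have hreal := realisable_blockRestrict_smul hG ({0, 1, 4, 5} : Finset (Fin 6)) x⁻¹
      refine not_realisable_disjointPattern 0 4 1 5 (by decide) (by decide) (by decide) (by decide) (by decide) (by decide) ?_
      convert hreal using 1
      ext a b
      rw [Matrix.of_apply, Matrix.of_apply, Matrix.of_apply]
      by_cases hab : a ∈ ({0, 1, 4, 5} : Finset (Fin 6)) ∧ b ∈ ({0, 1, 4, 5} : Finset (Fin 6))
      · rw [if_pos hab, hentry a b, hy0]
        obtain ⟨ha, hb⟩ := hab
        rw [hB1] at ha hb
        rcases ha with rfl | rfl | rfl | rfl <;> rcases hb with rfl | rfl | rfl | rfl <;> simp [hx0]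
      · rw [if_neg hab]
        simp only [not_and_or, hB1, not_or] at hab
        rcases hab with ⟨h1, h2, h3, h4⟩ | ⟨h1, h2, h3, h4⟩
        · simp [h1, h2, h3, h4]
        · simp [h1, h2, h3, h4]
    · push Not at hx0
      obtain ⟨p, q, hpq⟩ := hW
      exact hpq (by rw [hentry p q, hx0, hy0]; ring)

end Summit.ValiantsHypothesis.ValiantsHypothesis.Theorems.LacunarySymmetroidMatrixDescartes.WallBubbling
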